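import Summits.HubbardSuperconductivity.HubbardLadder.ObservableWindow
import Summits.HubbardSuperconductivity.HubbardLadder.NeelTwoSumRuleRows
import Literature.MathematicalPhysics.QuantumLattice.SpinHalfCasimirBound
import Literature.Probability.LatticeModels.TorusBipartite
import HarnessLib

/-!
# R2 rows: the operator ceiling `m_s²(L) ≤ ¼ + 1/L²` for the spin-½ Heisenberg model on the even torus, and two-sided kernel brackets for `m_s²(4)`, `m_s²(6)`

HONEST FRAMING: ladder R1–R4 with certified numbers; no claim on H/H₀. Cell pub-hubbard, seat r2
(gen 5). Each theorem is a statement about ONE finite matrix; none bears on H₀.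

The UPPER endpoint of the R2 observable `m_s²(L) = L⁻⁴ ω₀(𝓢)`, `𝓢 = Σ_{x,y} ε_x ε_y 𝐒_x·𝐒_y`
(`stagStructureOp`), for the tracial ground state `ω₀` of `heisenbergTorus 2 L 1 J` — in fact for
the tracial ground state of ANY Hermitian matrix on the torus Hilbert space, i.e. a pure operator
bound. With `A = {ε = +1}`, `B = {ε = -1}` (canonical-representative parity, `|A| = |B| = L²/2` for
even `L`) and `𝐒_A = Σ_{x∈A} 𝐒_x`:

  `𝓢 = Σ_α (S^α_A - S^α_B)² = 2𝐒_A² + 2𝐒_B² - 𝐒_tot²`  (operator identity, no commutation needed),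

so positivity of `ω₀`, `𝐒_tot² ⪰ 0` and the spin-½ Casimir bound `𝐒_Y² ≤ (|Y|/2)(|Y|/2+1)`
(`posSemidef_casimirBound_sub`, Tasaki 2020 App. A.3) give `ω₀(𝓢) ≤ L⁴/4 + L²`, i.e.
**`m_s²(L) ≤ ¼ + 1/L²`** (`neelOrderParamSq_le`; rows `neelOrderParamSq_four_le : m_s²(4) ≤ 0.3125`,
`_six_le : ≤ 0.2778`, `_eight_le : ≤ 0.265625`, `_ten_le : ≤ 0.26`). The bound is saturated up to
`O(1/L²)` by the Néel product state (`ω_Néel(𝓢) = L⁴/4`), so nothing better is available without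
using the Hamiltonian; it is the honest "operator ceiling" column of R2-TABLE §A8.

Together with the Kennedy–Lieb–Shastry lower rows of `NeelTwoSumRuleRows` this yields TWO-SIDED
brackets both of whose endpoints are kernel theorems with NO numerical input:
`neelOrderParamSq_four_mem_Icc : 0 < J → m_s²(4) ∈ [0.1637, 0.3125]`,
`neelOrderParamSq_six_mem_Icc : 0 < J → m_s²(6) ∈ [0.0786, 0.2778]`
(comparators, never inputs: `m_s²(4) = 0.2765271` ED, `m_s²(6) = 0.2098368(2)` QMC).
-/

noncomputable section

open Matrix Complex Finset Literature.MathematicalPhysics.QuantumLattice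
  Literature.Probability.LatticeModels
open scoped ComplexOrder

namespace Summit.HubbardSuperconductivity.HubbardLadder

/-! ### The staggered sign and the canonical-representative sublattices -/

section Stag

variable {L : ℕ} [NeZero L]

/-- The staggered sign `ε_x = (-1)^{Σᵢ x̄ᵢ}` on canonical representatives `x̄ᵢ ∈ {0,…,L-1}` (the sign
used in `neelOrderParamSq` / `stagStructureOp`). [folklore] -/
def stagSign (x : TorusSite 2 L) : ℝ := (-1) ^ (∑ i, (x i).val)

/-- The sublattice `A = {x : Σᵢ x̄ᵢ even} = {ε = +1}`. [folklore] -/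
def evenRepSites (L : ℕ) [NeZero L] : Finset (TorusSite 2 L) :=
  univ.filter fun x => Even (∑ i, (x i).val)

/-- `ε_x = 1` on `A`. [folklore] -/
theorem stagSign_of_mem {x : TorusSite 2 L} (hx : x ∈ evenRepSites L) : stagSign x = 1 := by
  unfold stagSign
  exact (Finset.mem_filter.mp hx).2.neg_one_pow

/-- `ε_x = -1` off `A`. [folklore] -/
theorem stagSign_of_not_mem {x : TorusSite 2 L} (hx : x ∉ evenRepSites L) : stagSign x = -1 := by
  unfold stagSign
  have h : ¬Even (∑ i, (x i).val) := fun he => hx (Finset.mem_filter.mpr ⟨Finset.mem_univ _, he⟩)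
  exact (Nat.not_even_iff_odd.mp h).neg_one_pow

/-- For even `L` the canonical-representative sublattice is the parity sublattice of
`Literature.Probability.LatticeModels.evenSublattice`. [folklore] -/
theorem evenRepSites_eq_evenSublattice (hL : 2 ∣ L) :
    evenRepSites L = evenSublattice (d := 2) L hL := by
  ext x
  rw [mem_evenSublattice_iff, evenRepSites, Finset.mem_filter]
  simp only [Finset.mem_univ, true_and, torusSiteParity, ZMod.castHom_apply, ZMod.cast_eq_val]
  rw [← Nat.cast_sum, ZMod.natCast_eq_zero_iff_even]

/-- `|Aᶜ| = |A|` for even `L`. [folklore] -/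
theorem card_compl_evenRepSites (hL : 2 ∣ L) :
    (evenRepSites L)ᶜ.card = (evenRepSites L).card := by
  rw [evenRepSites_eq_evenSublattice hL]
  exact card_compl_evenSublattice L hL 0

/-- `|A| + |Aᶜ| = L²`. [folklore] -/
theorem card_evenRepSites_add_card_compl :
    (evenRepSites L).card + (evenRepSites L)ᶜ.card = L ^ 2 := by
  rw [Finset.card_add_card_compl, Fintype.card_fun, ZMod.card, Fintype.card_fin]

/-! ### `𝓢 = Σ_α (S^α_A - S^α_B)² = 2𝐒_A² + 2𝐒_B² - 𝐒_tot²` -/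

/-- The staggered spin component `T^α = Σ_x ε_x S^α_x` (spin ½). [folklore] -/
def stagSpin (L : ℕ) [NeZero L] (α : Fin 3) : Op (TorusSite 2 L) 2 :=
  ∑ x : TorusSite 2 L, ((stagSign x : ℝ) : ℂ) • siteSpin 1 x α

/-- `𝓢 = Σ_α T^α T^α`. [folklore] -/
theorem stagStructureOp_one_eq_sum_stagSpin_mul (L : ℕ) [NeZero L] :
    stagStructureOp L 1 = ∑ α : Fin 3, stagSpin L α * stagSpin L α := by
  simp only [stagStructureOp, stagSpin, stagSign, Complex.ofReal_mul, Finset.smul_sum, Finset.sum_mul_sum,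
    smul_mul_assoc, mul_smul_comm, smul_smul]
  conv_rhs => rw [Finset.sum_comm]
  refine Finset.sum_congr rfl fun x _ => ?_
  rw [Finset.sum_comm]
  refine Finset.sum_congr rfl fun α _ => Finset.sum_congr rfl fun y _ => ?_
  rw [mul_comm]

/-- `T^α = S^α_A - S^α_{Aᶜ}`. [folklore] -/
theorem stagSpin_eq_sub (L : ℕ) [NeZero L] (α : Fin 3) :
    stagSpin L α = (∑ x ∈ evenRepSites L, siteSpin 1 x α) - ∑ x ∈ (evenRepSites L)ᶜ, siteSpin 1 x α := by
  rw [stagSpin, ← Finset.sum_add_sum_compl (evenRepSites L), sub_eq_add_neg, ← Finset.sum_neg_distrib]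
  congr 1
  · exact Finset.sum_congr rfl fun x hx => by rw [stagSign_of_mem hx]; simp
  · exact Finset.sum_congr rfl fun x hx => by
      rw [stagSign_of_not_mem (Finset.mem_compl.mp hx)]; simp

/-- `S^α_tot = S^α_A + S^α_{Aᶜ}`. [folklore] -/
theorem totalSpin_one_eq_add (L : ℕ) [NeZero L] (α : Fin 3) :
    (totalSpin 1 α : Op (TorusSite 2 L) 2) =
      (∑ x ∈ evenRepSites L, siteSpin 1 x α) + ∑ x ∈ (evenRepSites L)ᶜ, siteSpin 1 x α := by
  rw [totalSpin, Finset.sum_add_sum_compl]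

/-- `(a-b)² = (a² + a²) + (b² + b²) - (a+b)²` in any ring (no commutation used). [folklore] -/
private theorem sub_mul_sub_eq {R : Type*} [Ring R] (a b : R) :
    (a - b) * (a - b) = (a * a + a * a) + (b * b + b * b) - (a + b) * (a + b) := by
  simp only [sub_mul, mul_sub, add_mul, mul_add]
  abel

/-- **`𝓢 = 2𝐒_A² + 2𝐒_B² - 𝐒_tot²`** (written without numerals: `(𝐒_A² + 𝐒_A²) + (𝐒_B² + 𝐒_B²) - 𝐒_tot²`).
[folklore] -/
theorem stagStructureOp_one_eq (L : ℕ) [NeZero L] :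
    stagStructureOp L 1 =
      ((∑ α : Fin 3, (∑ x ∈ evenRepSites L, siteSpin 1 x α) * (∑ x ∈ evenRepSites L, siteSpin 1 x α)) +
          ∑ α : Fin 3, (∑ x ∈ evenRepSites L, siteSpin 1 x α) * (∑ x ∈ evenRepSites L, siteSpin 1 x α)) +
        ((∑ α : Fin 3, (∑ x ∈ (evenRepSites L)ᶜ, siteSpin 1 x α) * (∑ x ∈ (evenRepSites L)ᶜ, siteSpin 1 x α)) +
          ∑ α : Fin 3, (∑ x ∈ (evenRepSites L)ᶜ, siteSpin 1 x α) * (∑ x ∈ (evenRepSites L)ᶜ, siteSpin 1 x α)) -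
        (totalSpinSq 1 : Op (TorusSite 2 L) 2) := by
  rw [stagStructureOp_one_eq_sum_stagSpin_mul, totalSpinSq]
  simp only [← Finset.sum_add_distrib, ← Finset.sum_sub_distrib]
  refine Finset.sum_congr rfl fun α _ => ?_
  rw [stagSpin_eq_sub, totalSpin_one_eq_add]
  exact sub_mul_sub_eq _ _

end Stag

/-! ### State bounds: `Re ω₀(X) ≤ c` from `c·1 - X ⪰ 0` -/

section StateBounds

variable {n : Type*} [Fintype n] [DecidableEq n]

/-- Positivity of the tracial ground state in Loewner form: `c·1 - X ⪰ 0 ⇒ Re ω₀(X) ≤ c`. [folklore] -/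
theorem re_groundStateFunctional_le_of_posSemidef [Nonempty n] {A X : Matrix n n ℂ} (hA : A.IsHermitian) {c : ℝ}
    (h : ((c : ℂ) • (1 : Matrix n n ℂ) - X).PosSemidef) : (A.groundStateFunctional X).re ≤ c := by
  have h0 := Matrix.groundStateFunctional_nonneg_of_posSemidef A h
  rw [map_sub, map_smul, Matrix.groundStateFunctional_one hA, smul_eq_mul, mul_one] at h0
  have h1 := (Complex.nonneg_iff.mp h0).1
  rw [Complex.sub_re, Complex.ofReal_re] at h1
  linarith

/-- `X ⪰ 0 ⇒ 0 ≤ Re ω₀(X)`. [folklore] -/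
theorem re_groundStateFunctional_nonneg_of_posSemidef (A : Matrix n n ℂ) {X : Matrix n n ℂ}
    (h : X.PosSemidef) : 0 ≤ (A.groundStateFunctional X).re :=
  (Complex.nonneg_iff.mp (Matrix.groundStateFunctional_nonneg_of_posSemidef A h)).1

end StateBounds

/-! ### The ceiling -/

section Ceiling

variable {L : ℕ} [NeZero L]

/-- Casimir bound in the tracial ground state of any Hermitian `A`: `Re ω₀(𝐒_Y²) ≤ |Y|(|Y|+2)/4`.
[cite: Tasaki2020, §2.2, App. A.3] -/
theorem re_groundStateFunctional_setSpinSq_le {A : Op (TorusSite 2 L) 2} (hA : A.IsHermitian)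
    (Y : Finset (TorusSite 2 L)) :
    (A.groundStateFunctional
        (∑ α : Fin 3, (∑ x ∈ Y, siteSpin 1 x α) * (∑ x ∈ Y, siteSpin 1 x α))).re ≤
      (Y.card : ℝ) * (Y.card + 2) / 4 := by
  apply re_groundStateFunctional_le_of_posSemidef hA
  have h := posSemidef_casimirBound_sub (Λ := TorusSite 2 L) Y
  have hc : (((Y.card : ℝ) * (Y.card + 2) / 4 : ℝ) : ℂ) = (Y.card : ℂ) * (Y.card + 2) / 4 := by
    push_cast; ring
  rw [hc]
  exact h

/-- `0 ≤ Re ω₀(𝐒_tot²)` (`𝐒_tot² = Σ_α (S^α_tot)ᴴ S^α_tot ⪰ 0`). [folklore] -/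
theorem re_groundStateFunctional_totalSpinSq_nonneg (A : Op (TorusSite 2 L) 2) :
    0 ≤ (A.groundStateFunctional (totalSpinSq 1 : Op (TorusSite 2 L) 2)).re := by
  refine re_groundStateFunctional_nonneg_of_posSemidef A ?_
  rw [totalSpinSq]
  refine posSemidef_finset_sum _ fun α _ => ?_
  have hh := (totalSpin_isHermitian (Λ := TorusSite 2 L) 1 α).eq
  simpa [hh] using posSemidef_conjTranspose_mul_self (totalSpin (Λ := TorusSite 2 L) 1 α)

/-- **`ω₀(𝓢) ≤ L⁴/4 + L²`** for the tracial ground state of ANY Hermitian `A` on the even torus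
`(ℤ/Lℤ)²` (spin ½). [cite: Tasaki2020, §2.2, App. A.3] -/
theorem re_groundStateFunctional_stagStructureOp_le {A : Op (TorusSite 2 L) 2} (hA : A.IsHermitian)
    (hL : 2 ∣ L) :
    (A.groundStateFunctional (stagStructureOp L 1)).re ≤ (L : ℝ) ^ 4 / 4 + (L : ℝ) ^ 2 := by
  have hcc := card_compl_evenRepSites (L := L) hL
  have hsum := card_evenRepSites_add_card_compl (L := L)
  rw [hcc] at hsum
  have hM : ((evenRepSites L).card : ℝ) = (L : ℝ) ^ 2 / 2 := by
    have h' : (((evenRepSites L).card + (evenRepSites L).card : ℕ) : ℝ) = ((L ^ 2 : ℕ) : ℝ) := by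
      rw [hsum]
    push_cast at h'
    linarith
  have hA1 := re_groundStateFunctional_setSpinSq_le hA (evenRepSites L)
  have hB1 := re_groundStateFunctional_setSpinSq_le hA (evenRepSites L)ᶜ
  rw [hcc] at hB1
  have hT := re_groundStateFunctional_totalSpinSq_nonneg A
  rw [stagStructureOp_one_eq, map_sub, map_add, map_add, map_add, Complex.sub_re, Complex.add_re,
    Complex.add_re, Complex.add_re]
  have hkey : ((evenRepSites L).card : ℝ) * ((evenRepSites L).card + 2) / 4 =
      ((L : ℝ) ^ 4 / 4 + (L : ℝ) ^ 2) / 4 := by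
    rw [hM]; ring
  rw [hkey] at hA1 hB1
  linarith

/-- **R2 operator ceiling: `m_s²(L) ≤ ¼ + 1/L²`** for even `L` and every `J` (a bound on ONE finite
matrix's ground-state functional; no bearing on H₀). [cite: Tasaki2020, §2.2, App. A.3] -/
theorem neelOrderParamSq_le (k : ℕ) (hk : 2 ∣ k + 1) (J : ℝ) :
    neelOrderParamSq (k + 1) J ≤ 1 / 4 + 1 / ((k + 1 : ℕ) : ℝ) ^ 2 := by
  rw [neelOrderParamSq_succ_eq_re_groundStateFunctional, div_le_iff₀ (by positivity)]
  have h := re_groundStateFunctional_stagStructureOp_le (heisenbergTorus_isHermitian 2 (k + 1) 1 J) hk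
  have hL : (0 : ℝ) < ((k + 1 : ℕ) : ℝ) := by positivity
  calc ((heisenbergTorus 2 (k + 1) 1 J).groundStateFunctional (stagStructureOp (k + 1) 1)).re
      ≤ ((k + 1 : ℕ) : ℝ) ^ 4 / 4 + ((k + 1 : ℕ) : ℝ) ^ 2 := h
    _ = (1 / 4 + 1 / ((k + 1 : ℕ) : ℝ) ^ 2) * ((k + 1 : ℕ) : ℝ) ^ 4 := by
      field_simp

/-! ### Rows (R2-TABLE §A8, column "operator ceiling") and two-sided brackets -/

/-- Row A8.4 upper: `m_s²(4) ≤ 0.3125 = ¼ + 1/16`. [cite: Tasaki2020, §2.2, App. A.3] -/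
theorem neelOrderParamSq_four_le (J : ℝ) : neelOrderParamSq 4 J ≤ 0.3125 := by
  have h := neelOrderParamSq_le 3 (by norm_num) J
  norm_num at h ⊢
  exact h

/-- Row A8.6 upper: `m_s²(6) ≤ 0.2778` (`¼ + 1/36 = 0.27̄`). [cite: Tasaki2020, §2.2, App. A.3] -/
theorem neelOrderParamSq_six_le (J : ℝ) : neelOrderParamSq 6 J ≤ 0.2778 := by
  have h := neelOrderParamSq_le 5 (by norm_num) J
  norm_num at h ⊢
  linarith

/-- Row A8.8 upper: `m_s²(8) ≤ 0.265625 = ¼ + 1/64`. [cite: Tasaki2020, §2.2, App. A.3] -/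
theorem neelOrderParamSq_eight_le (J : ℝ) : neelOrderParamSq 8 J ≤ 0.265625 := by
  have h := neelOrderParamSq_le 7 (by norm_num) J
  norm_num at h ⊢
  exact h

/-- Row A8.10 upper: `m_s²(10) ≤ 0.26 = ¼ + 1/100`. [cite: Tasaki2020, §2.2, App. A.3] -/
theorem neelOrderParamSq_ten_le (J : ℝ) : neelOrderParamSq 10 J ≤ 0.26 := by
  have h := neelOrderParamSq_le 9 (by norm_num) J
  norm_num at h ⊢
  exact h

/-- **Two-sided kernel bracket, `4×4`**: `0 < J → m_s²(4) ∈ [0.1637, 0.3125]` (lower: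
Kennedy–Lieb–Shastry two-sum rule `neelOrderParamSq_four_ge`; upper: operator ceiling). No numerical
input. [cite: KLS1988JSP, eqs. (2)-(4), (6)-(9)] [cite: Tasaki2020, App. A.3] -/
theorem neelOrderParamSq_four_mem_Icc (J : ℝ) (hJ : 0 < J) :
    neelOrderParamSq 4 J ∈ Set.Icc (0.1637 : ℝ) 0.3125 :=
  ⟨neelOrderParamSq_four_ge J hJ, neelOrderParamSq_four_le J⟩

/-- **Two-sided kernel bracket, `6×6`**: `0 < J → m_s²(6) ∈ [0.0786, 0.2778]`. No numerical input.
[cite: KLS1988JSP, eqs. (2)-(4), (6)-(9)] [cite: Tasaki2020, App. A.3] -/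
theorem neelOrderParamSq_six_mem_Icc (J : ℝ) (hJ : 0 < J) :
    neelOrderParamSq 6 J ∈ Set.Icc (0.0786 : ℝ) 0.2778 :=
  ⟨neelOrderParamSq_six_ge J hJ, neelOrderParamSq_six_le J⟩

end Ceiling

end Summit.HubbardSuperconductivity.HubbardLadder
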